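import Summits.AtomisticToContinuum.Crystallization.Theorems.FrustratedLawDichotomyStrainedPatchHomSplitNarrow
import Summits.AtomisticToContinuum.Crystallization.Theorems.FrustratedLawDichotomyStrainedPatchHomPrunedPolar

/-!
# `(H_W) HomFloorW ρ_U ρ_ξ m` — the NARROW-family root chain: lattice sums, pruned box sums, and the polar (self-adjoint) reduction at radii `(ρ_U, ρ_ξ)`

decomp-a2c hand-1 g45 (crux `AperiodicFrustratedLawGap`, stmt-AtomisticToContinuum-27623; `(H) HomFloor`; sequel of `…StrainedPatchHomSplitNarrow`).
The record root chain `…HomLattice.homFloor_iff_latticeSums` → `…HomPruned.homFloor_of_prunedBoxSums` → `…HomPolar.forall_near_one_of_forall_selfAdjoint` /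
`…HomIsometry.prunedBoxSum_fcc/hcp_reduction` → `…HomPrunedPolar.homFloor_of_prunedBoxSums_selfAdjoint` is typed at the record radii `‖G − 1‖ ≤ 1/4`,
`‖ξ‖ ≤ 1/4`.  Every step is radius-agnostic (the per-instance identities `ballAvg_xRec_eq_latticeSum_fcc/hcp` carry no radius; the polar factor
`exists_polar_of_near_one` is stated for any `ε < 1`; the box identities `latticeSum_fcc/hcp_eq_boxSum_record` need only `≤ 1/4`).  This DEF-FREE file threads
arbitrary radii `ρ_U ≤ 1/4`, `ρ_ξ ≤ 1/4` through the chain, so that a certificate over the NARROW quarter root box proves `HomFloorW ρ_U ρ_ξ m` by name: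

* §1 `homFloorW_iff_latticeSums` (exact reduction to the realised lattice-sum inequalities at radii `(ρ_U, ρ_ξ)`), `homFloorW_of_latticeSums`;
* §2 `homFloorW_of_prunedBoxSums` (prune disjunct ∨ literal `[−7,7]³` box floor, per `‖G − 1‖ ≤ ρ_U`, `‖ξ‖ ≤ ρ_ξ`);
* §3 `forall_near_of_forall_selfAdjoint` (O(3) reduction at any `ε < 1`), `prunedBoxSum_fcc_reduction_rad`, `prunedBoxSum_hcp_reduction_rad`;
* §4 ★ `homFloorW_of_prunedBoxSums_selfAdjoint` — `(H_W)` from pruned box sums over SELF-ADJOINT POSITIVE `U` with `‖U − 1‖ ≤ ρ_U` (hcp: `‖ξ‖ ≤ ρ_ξ`).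

Proofs are the record proofs with the radii threaded; nothing landed is modified.  0 sorry; no definitions; standard axioms; no instances / notation /
`#eval`.  `--supports stmt-AtomisticToContinuum-27623`.
-/

noncomputable section

namespace Summit.AtomisticToContinuum.Crystallization.Theorems.FrustratedLawDichotomyStrainedPatchHomSplitNarrow

open scoped BigOperators Classical RealInnerProductSpace
open Summit.AtomisticToContinuum.Crystallization.Theorems.ChargedEnergyGapNegative (E3)
open Summit.AtomisticToContinuum.Crystallization.Theorems.FrustratedLawDichotomyRangeCut (Sep)
open Summit.AtomisticToContinuum.Crystallization.Theorems.FrustratedLawDichotomySchurCut (effPot w₄₅ ω₄)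
open Summit.AtomisticToContinuum.Crystallization.Theorems.FrustratedLawDichotomyAveragingRuleTightFree (TightNearCap BadNearCap)
open Summit.AtomisticToContinuum.Crystallization.Theorems.FrustratedLawDichotomyExemptAbsorption (ExemptNear)
open Summit.AtomisticToContinuum.Crystallization.Theorems.FrustratedLawDichotomyStrainedPatchHomSplit
open Summit.AtomisticToContinuum.Crystallization.Theorems.FrustratedLawDichotomyStrainedPatchHomLattice
open Summit.AtomisticToContinuum.Crystallization.Theorems.FrustratedLawDichotomyStrainedPatchHomLatticeBox
open Summit.AtomisticToContinuum.Crystallization.Theorems.FrustratedLawDichotomyStrainedPatchHomLatticeBoxHcp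
open Summit.AtomisticToContinuum.Crystallization.Theorems.FrustratedLawDichotomyStrainedPatchHomPolar
open Summit.AtomisticToContinuum.Crystallization.Theorems.FrustratedLawDichotomyStrainedPatchHomIsometry
open Summit.AtomisticToContinuum.Crystallization.Theorems.FrustratedLawDichotomyStrainedPatchHomPruned
open Literature.Barriers.AtomisticToContinuum.FlatleyTheil2015 (fccVec)

/-! ## §1. `(H_W)` IS the pair of lattice-sum inequalities over the realised deformations of the narrow family -/

/-- ★ **`HomFloorW ρ_U ρ_ξ m` IS the pair of lattice-sum inequalities over the REALISED deformations with `‖G − 1‖ ≤ ρ_U` (hcp: `‖ξ‖ ≤ ρ_ξ`)** —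
the record `homFloor_iff_latticeSums` with the radii threaded (`0 ≤ ρ_ξ` is needed only to realise the fcc instances, whose shuffle slot is `ξ = 0`).
[folklore] -/
theorem homFloorW_iff_latticeSums {ρU ρξ m : ℝ} (hρξ : 0 ≤ ρξ) :
    HomFloorW ρU ρξ m ↔
      (∀ G : E3 →L[ℝ] E3, ‖G - 1‖ ≤ ρU →
        (∃ (M : ℕ) (z : Fin M → E3) (c : Fin M), Admissible M z c ∧
          Set.range z = {x : E3 | dist x (z c) ≤ 133 / 10 ∧ ∃ a : Fin 3 → ℤ, x = z c + latPt G fccVec a}) →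
        m ≤ (∑ᶠ v ∈ {v : E3 | v ≠ 0 ∧ ∃ b : Fin 3 → ℤ, v = latPt G fccVec b}, effPot w₄₅ ω₄ (3 / 400) ‖v‖) / 2 - (-(7175 / 10000) + 3 / 400)) ∧
      (∀ (G : E3 →L[ℝ] E3) (ξ : E3), ‖G - 1‖ ≤ ρU → ‖ξ‖ ≤ ρξ →
        (∃ (M : ℕ) (z : Fin M → E3) (c : Fin M), Admissible M z c ∧
          Set.range z = {x : E3 | dist x (z c) ≤ 133 / 10 ∧ ∃ a : Fin 3 → ℤ,
            x = z c + latPt G hexFrame a ∨ x = z c + latPt G hexFrame a + G (hcpShift + ξ)}) →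
        m ≤ (∑ᶠ v ∈ {v : E3 | v ≠ 0 ∧ ∃ b : Fin 3 → ℤ, v = latPt G hexFrame b ∨ v = latPt G hexFrame b + G (hcpShift + ξ)},
          effPot w₄₅ ω₄ (3 / 400) ‖v‖) / 2 - (-(7175 / 10000) + 3 / 400)) := by
  constructor
  · intro h
    refine ⟨fun G hG ⟨M, z, c, hA, hrange⟩ => ?_, fun G ξ hG hξ ⟨M, z, c, hA, hrange⟩ => ?_⟩
    · rw [← ballAvg_xRec_eq_latticeSum_fcc hA hrange]
      exact h M z c hA ⟨G, 0, hG, by rw [norm_zero]; exact hρξ, Or.inl hrange⟩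
    · rw [← ballAvg_xRec_eq_latticeSum_hcp hA hrange]
      exact h M z c hA ⟨G, ξ, hG, hξ, Or.inr hrange⟩
  · rintro ⟨hfcc, hhcp⟩ M z c hA ⟨G, ξ, hG, hξ, hrange | hrange⟩
    · rw [ballAvg_xRec_eq_latticeSum_fcc hA hrange]
      exact hfcc G hG ⟨M, z, c, hA, hrange⟩
    · rw [ballAvg_xRec_eq_latticeSum_hcp hA hrange]
      exact hhcp G ξ hG hξ ⟨M, z, c, hA, hrange⟩

/-- ★ **Realised lattice-sum inequalities ⟹ `(H_W)`** (the `←` half, no sign condition on `ρ_ξ`). [folklore] -/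
theorem homFloorW_of_realised_latticeSums {ρU ρξ m : ℝ}
    (hfcc : ∀ G : E3 →L[ℝ] E3, ‖G - 1‖ ≤ ρU →
        (∃ (M : ℕ) (z : Fin M → E3) (c : Fin M), Admissible M z c ∧
          Set.range z = {x : E3 | dist x (z c) ≤ 133 / 10 ∧ ∃ a : Fin 3 → ℤ, x = z c + latPt G fccVec a}) →
        m ≤ (∑ᶠ v ∈ {v : E3 | v ≠ 0 ∧ ∃ b : Fin 3 → ℤ, v = latPt G fccVec b}, effPot w₄₅ ω₄ (3 / 400) ‖v‖) / 2 - (-(7175 / 10000) + 3 / 400))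
    (hhcp : ∀ (G : E3 →L[ℝ] E3) (ξ : E3), ‖G - 1‖ ≤ ρU → ‖ξ‖ ≤ ρξ →
        (∃ (M : ℕ) (z : Fin M → E3) (c : Fin M), Admissible M z c ∧
          Set.range z = {x : E3 | dist x (z c) ≤ 133 / 10 ∧ ∃ a : Fin 3 → ℤ,
            x = z c + latPt G hexFrame a ∨ x = z c + latPt G hexFrame a + G (hcpShift + ξ)}) →
        m ≤ (∑ᶠ v ∈ {v : E3 | v ≠ 0 ∧ ∃ b : Fin 3 → ℤ, v = latPt G hexFrame b ∨ v = latPt G hexFrame b + G (hcpShift + ξ)},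
          effPot w₄₅ ω₄ (3 / 400) ‖v‖) / 2 - (-(7175 / 10000) + 3 / 400)) :
    HomFloorW ρU ρξ m := by
  rintro M z c hA ⟨G, ξ, hG, hξ, hrange | hrange⟩
  · rw [ballAvg_xRec_eq_latticeSum_fcc hA hrange]
    exact hfcc G hG ⟨M, z, c, hA, hrange⟩
  · rw [ballAvg_xRec_eq_latticeSum_hcp hA hrange]
    exact hhcp G ξ hG hξ ⟨M, z, c, hA, hrange⟩

/-- **Realisability-free sufficient form** at radii `(ρ_U, ρ_ξ)` (what a bare branch-and-bound certifies; vacuous in practice at `m = 1/625`, kept for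
symmetry with `…HomLattice.homFloor_of_latticeSums`). [folklore] -/
theorem homFloorW_of_latticeSums {ρU ρξ m : ℝ}
    (hfcc : ∀ G : E3 →L[ℝ] E3, ‖G - 1‖ ≤ ρU →
      m ≤ (∑ᶠ v ∈ {v : E3 | v ≠ 0 ∧ ∃ b : Fin 3 → ℤ, v = latPt G fccVec b}, effPot w₄₅ ω₄ (3 / 400) ‖v‖) / 2 - (-(7175 / 10000) + 3 / 400))
    (hhcp : ∀ (G : E3 →L[ℝ] E3) (ξ : E3), ‖G - 1‖ ≤ ρU → ‖ξ‖ ≤ ρξ →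
      m ≤ (∑ᶠ v ∈ {v : E3 | v ≠ 0 ∧ ∃ b : Fin 3 → ℤ, v = latPt G hexFrame b ∨ v = latPt G hexFrame b + G (hcpShift + ξ)},
        effPot w₄₅ ω₄ (3 / 400) ‖v‖) / 2 - (-(7175 / 10000) + 3 / 400)) :
    HomFloorW ρU ρξ m :=
  homFloorW_of_realised_latticeSums (fun G hG _ => hfcc G hG) (fun G ξ hG hξ _ => hhcp G ξ hG hξ)

/-! ## §2. `(H_W)` from PRUNED box-sum inequalities at radii `(ρ_U, ρ_ξ)` -/

/-- ★★ **`(H_W)` FROM PRUNED BOX-SUM INEQUALITIES** — the record `homFloor_of_prunedBoxSums` with the radii threaded (`ρ_U, ρ_ξ ≤ 1/4` so that the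
literal box `[−7,7]³` carries the whole lattice sum, `latticeSum_fcc/hcp_eq_boxSum_record`). [folklore] -/
theorem homFloorW_of_prunedBoxSums {ρU ρξ m : ℝ} (hρU : ρU ≤ 1 / 4) (hρξ : ρξ ≤ 1 / 4)
    (hfcc : ∀ G : E3 →L[ℝ] E3, ‖G - 1‖ ≤ ρU →
      (∀ (M : ℕ) (z : Fin M → E3) (c : Fin M), Function.Injective z →
          Set.range z = {x : E3 | dist x (z c) ≤ 133 / 10 ∧ ∃ a : Fin 3 → ℤ, x = z c + latPt G fccVec a} →
          TightNearCap (9 / 5) (3 / 2) z c ∨ ExemptNear (9 / 5) ExRec z c ∨ BadNearCap (9 / 5) (3 / 2) z c) ∨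
      m ≤ (∑ b ∈ (Fintype.piFinset fun _ : Fin 3 => Finset.Icc (-7 : ℤ) 7).filter (fun b => b ≠ 0),
        effPot w₄₅ ω₄ (3 / 400) ‖latPt G fccVec b‖) / 2 - (-(7175 / 10000) + 3 / 400))
    (hhcp : ∀ (G : E3 →L[ℝ] E3) (ξ : E3), ‖G - 1‖ ≤ ρU → ‖ξ‖ ≤ ρξ →
      (∀ (M : ℕ) (z : Fin M → E3) (c : Fin M), Function.Injective z →
          Set.range z = {x : E3 | dist x (z c) ≤ 133 / 10 ∧ ∃ a : Fin 3 → ℤ,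
            x = z c + latPt G hexFrame a ∨ x = z c + latPt G hexFrame a + G (hcpShift + ξ)} →
          ¬Sep z ∨ TightNearCap (9 / 5) (3 / 2) z c ∨ ExemptNear (9 / 5) ExRec z c ∨ BadNearCap (9 / 5) (3 / 2) z c) ∨
      m ≤ (∑ b ∈ (Fintype.piFinset fun _ : Fin 3 => Finset.Icc (-7 : ℤ) 7).filter (fun b => b ≠ 0),
          effPot w₄₅ ω₄ (3 / 400) ‖latPt G hexFrame b‖ +
        ∑ b ∈ (Fintype.piFinset fun _ : Fin 3 => Finset.Icc (-7 : ℤ) 7),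
          effPot w₄₅ ω₄ (3 / 400) ‖latPt G hexFrame b + G (hcpShift + ξ)‖) / 2 - (-(7175 / 10000) + 3 / 400)) :
    HomFloorW ρU ρξ m := by
  refine homFloorW_of_realised_latticeSums (fun G hG ⟨M, z, c, hA, hrange⟩ => ?_) (fun G ξ hG hξ ⟨M, z, c, hA, hrange⟩ => ?_)
  · rcases hfcc G hG with hprune | hfloor
    · rcases hprune M z c hA.1 hrange with hT | hE | hB
      · exact absurd hT hA.2.2.2.1
      · exact absurd hE hA.2.2.2.2.1
      · exact absurd hB hA.2.2.2.2.2
    · rw [latticeSum_fcc_eq_boxSum_record (hG.trans hρU)]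
      exact hfloor
  · rcases hhcp G ξ hG hξ with hprune | hfloor
    · rcases hprune M z c hA.1 hrange with hS | hT | hE | hB
      · exact absurd hA.2.1 hS
      · exact absurd hT hA.2.2.2.1
      · exact absurd hE hA.2.2.2.2.1
      · exact absurd hB hA.2.2.2.2.2
    · rw [latticeSum_hcp_eq_boxSum_record (hG.trans hρU) (hξ.trans hρξ)]
      exact hfloor

/-! ## §3. The O(3) reduction at any radius `ε < 1` -/

/-- ★ **O(3) REDUCTION at radius `ε < 1`**: a property of deformations invariant under post-composition with linear isometries holds for all
`‖G − 1‖ ≤ ε` as soon as it holds for all self-adjoint positive `U` with `‖U − 1‖ ≤ ε` (the record `forall_near_one_of_forall_selfAdjoint` is `ε = 1/4`;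
`exists_polar_of_near_one` is already stated for any `ε < 1`). [folklore] -/
theorem forall_near_of_forall_selfAdjoint {ε : ℝ} (hε : ε < 1) {P : (E3 →L[ℝ] E3) → Prop}
    (hinv : ∀ (R : E3 ≃ₗᵢ[ℝ] E3) (U : E3 →L[ℝ] E3), P U → P ((R : E3 →L[ℝ] E3).comp U))
    (hU : ∀ U : E3 →L[ℝ] E3, (∀ v w : E3, ⟪U v, w⟫ = ⟪v, U w⟫) → (∀ w : E3, 0 ≤ ⟪w, U w⟫) → ‖U - 1‖ ≤ ε → P U) :
    ∀ G : E3 →L[ℝ] E3, ‖G - 1‖ ≤ ε → P G := by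
  intro G hG
  obtain ⟨R, U, hsa, hpos, hU1, -, hGRU⟩ := exists_polar_of_near_one hG hε
  have hG' : G = (R : E3 →L[ℝ] E3).comp U := by
    ext w : 1
    rw [hGRU w]; rfl
  rw [hG']
  exact hinv R U (hU U hsa hpos hU1)

/-- ★ **PRUNED fcc CERTIFICATE REDUCES TO THE POLAR FACTOR, at radius `ε < 1`** (record: `…HomIsometry.prunedBoxSum_fcc_reduction`, `ε = 1/4`).
[folklore] -/
theorem prunedBoxSum_fcc_reduction_rad {ε m e ϱ : ℝ} (hε : ε < 1) {W : ℝ → ℝ} {box : Finset (Fin 3 → ℤ)} {f : Fin 3 → E3}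
    (hU : ∀ U : E3 →L[ℝ] E3, (∀ v w : E3, ⟪U v, w⟫ = ⟪v, U w⟫) → (∀ w : E3, 0 ≤ ⟪w, U w⟫) → ‖U - 1‖ ≤ ε →
      (∀ (M : ℕ) (z : Fin M → E3) (c : Fin M), Function.Injective z →
        Set.range z = {x | dist x (z c) ≤ ϱ ∧ ∃ a : Fin 3 → ℤ, x = z c + latPt U f a} →
        TightNearCap (9 / 5) (3 / 2) z c ∨ ExemptNear (9 / 5) ExRec z c ∨ BadNearCap (9 / 5) (3 / 2) z c) ∨
      m ≤ (∑ b ∈ box, W ‖latPt U f b‖) / 2 - e) :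
    ∀ G : E3 →L[ℝ] E3, ‖G - 1‖ ≤ ε →
      (∀ (M : ℕ) (z : Fin M → E3) (c : Fin M), Function.Injective z →
        Set.range z = {x | dist x (z c) ≤ ϱ ∧ ∃ a : Fin 3 → ℤ, x = z c + latPt G f a} →
        TightNearCap (9 / 5) (3 / 2) z c ∨ ExemptNear (9 / 5) ExRec z c ∨ BadNearCap (9 / 5) (3 / 2) z c) ∨
      m ≤ (∑ b ∈ box, W ‖latPt G f b‖) / 2 - e := by
  refine forall_near_of_forall_selfAdjoint hε ?_ hU
  rintro R U (h | h)
  · exact Or.inl (pruneFcc_comp R U f ϱ h)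
  · right; simpa only [norm_latPt_comp] using h

/-- ★ **PRUNED hcp CERTIFICATE REDUCES TO THE POLAR FACTOR, at radii `(ε, ρ_ξ)`, `ε < 1`** (record: `…HomIsometry.prunedBoxSum_hcp_reduction`).
[folklore] -/
theorem prunedBoxSum_hcp_reduction_rad {ε ρξ m e ϱ : ℝ} (hε : ε < 1) {W : ℝ → ℝ} {box box' : Finset (Fin 3 → ℤ)} {f : Fin 3 → E3} {s : E3}
    (hU : ∀ (U : E3 →L[ℝ] E3) (ξ : E3), (∀ v w : E3, ⟪U v, w⟫ = ⟪v, U w⟫) → (∀ w : E3, 0 ≤ ⟪w, U w⟫) →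
      ‖U - 1‖ ≤ ε → ‖ξ‖ ≤ ρξ →
      (∀ (M : ℕ) (z : Fin M → E3) (c : Fin M), Function.Injective z →
        Set.range z = {x | dist x (z c) ≤ ϱ ∧ ∃ a : Fin 3 → ℤ, x = z c + latPt U f a ∨ x = z c + latPt U f a + U (s + ξ)} →
        TightNearCap (9 / 5) (3 / 2) z c ∨ ExemptNear (9 / 5) ExRec z c ∨ BadNearCap (9 / 5) (3 / 2) z c) ∨
      m ≤ (∑ b ∈ box, W ‖latPt U f b‖ + ∑ b ∈ box', W ‖latPt U f b + U (s + ξ)‖) / 2 - e) :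
    ∀ (G : E3 →L[ℝ] E3) (ξ : E3), ‖G - 1‖ ≤ ε → ‖ξ‖ ≤ ρξ →
      (∀ (M : ℕ) (z : Fin M → E3) (c : Fin M), Function.Injective z →
        Set.range z = {x | dist x (z c) ≤ ϱ ∧ ∃ a : Fin 3 → ℤ, x = z c + latPt G f a ∨ x = z c + latPt G f a + G (s + ξ)} →
        TightNearCap (9 / 5) (3 / 2) z c ∨ ExemptNear (9 / 5) ExRec z c ∨ BadNearCap (9 / 5) (3 / 2) z c) ∨
      m ≤ (∑ b ∈ box, W ‖latPt G f b‖ + ∑ b ∈ box', W ‖latPt G f b + G (s + ξ)‖) / 2 - e := by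
  intro G ξ hG hξ
  revert hξ
  refine forall_near_of_forall_selfAdjoint hε
    (P := fun G => ‖ξ‖ ≤ ρξ →
      (∀ (M : ℕ) (z : Fin M → E3) (c : Fin M), Function.Injective z →
        Set.range z = {x | dist x (z c) ≤ ϱ ∧ ∃ a : Fin 3 → ℤ, x = z c + latPt G f a ∨ x = z c + latPt G f a + G (s + ξ)} →
        TightNearCap (9 / 5) (3 / 2) z c ∨ ExemptNear (9 / 5) ExRec z c ∨ BadNearCap (9 / 5) (3 / 2) z c) ∨
      m ≤ (∑ b ∈ box, W ‖latPt G f b‖ + ∑ b ∈ box', W ‖latPt G f b + G (s + ξ)‖) / 2 - e)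
    ?_ (fun U hsa hpos hU1 hξ => hU U ξ hsa hpos hU1 hξ) G hG
  rintro R U h hξ
  rcases h hξ with h | h
  · exact Or.inl (pruneHcp_comp R U f (s + ξ) ϱ h)
  · right; simpa only [norm_latPt_comp, norm_latPt_add_comp] using h

/-! ## §4. `(H_W)` from pruned box sums over the polar factor at radii `(ρ_U, ρ_ξ)` -/

/-- ★★★ **`(H_W) HomFloorW ρ_U ρ_ξ m` FROM PRUNED BOX SUMS OVER SELF-ADJOINT POSITIVE `U` ONLY** (`‖U − 1‖ ≤ ρ_U ≤ 1/4`; hcp additionally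
`‖ξ‖ ≤ ρ_ξ ≤ 1/4`) — the record `homFloor_of_prunedBoxSums_selfAdjoint` with the radii threaded: the statement a branch-and-bound certificate over the
NARROW quarter root box establishes leaf by leaf. [folklore] -/
theorem homFloorW_of_prunedBoxSums_selfAdjoint {ρU ρξ m : ℝ} (hρU : ρU ≤ 1 / 4) (hρξ : ρξ ≤ 1 / 4)
    (hfcc : ∀ U : E3 →L[ℝ] E3, (∀ v w : E3, ⟪U v, w⟫ = ⟪v, U w⟫) → (∀ w : E3, 0 ≤ ⟪w, U w⟫) → ‖U - 1‖ ≤ ρU →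
      (∀ (M : ℕ) (z : Fin M → E3) (c : Fin M), Function.Injective z →
          Set.range z = {x : E3 | dist x (z c) ≤ 133 / 10 ∧ ∃ a : Fin 3 → ℤ, x = z c + latPt U fccVec a} →
          TightNearCap (9 / 5) (3 / 2) z c ∨ ExemptNear (9 / 5) ExRec z c ∨ BadNearCap (9 / 5) (3 / 2) z c) ∨
      m ≤ (∑ b ∈ (Fintype.piFinset fun _ : Fin 3 => Finset.Icc (-7 : ℤ) 7).filter (fun b => b ≠ 0),
        effPot w₄₅ ω₄ (3 / 400) ‖latPt U fccVec b‖) / 2 - (-(7175 / 10000) + 3 / 400))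
    (hhcp : ∀ (U : E3 →L[ℝ] E3) (ξ : E3), (∀ v w : E3, ⟪U v, w⟫ = ⟪v, U w⟫) → (∀ w : E3, 0 ≤ ⟪w, U w⟫) →
      ‖U - 1‖ ≤ ρU → ‖ξ‖ ≤ ρξ →
      (∀ (M : ℕ) (z : Fin M → E3) (c : Fin M), Function.Injective z →
          Set.range z = {x : E3 | dist x (z c) ≤ 133 / 10 ∧ ∃ a : Fin 3 → ℤ,
            x = z c + latPt U hexFrame a ∨ x = z c + latPt U hexFrame a + U (hcpShift + ξ)} →
          TightNearCap (9 / 5) (3 / 2) z c ∨ ExemptNear (9 / 5) ExRec z c ∨ BadNearCap (9 / 5) (3 / 2) z c) ∨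
      m ≤ (∑ b ∈ (Fintype.piFinset fun _ : Fin 3 => Finset.Icc (-7 : ℤ) 7).filter (fun b => b ≠ 0),
          effPot w₄₅ ω₄ (3 / 400) ‖latPt U hexFrame b‖ +
        ∑ b ∈ (Fintype.piFinset fun _ : Fin 3 => Finset.Icc (-7 : ℤ) 7),
          effPot w₄₅ ω₄ (3 / 400) ‖latPt U hexFrame b + U (hcpShift + ξ)‖) / 2 - (-(7175 / 10000) + 3 / 400)) :
    HomFloorW ρU ρξ m :=
  have hε : ρU < 1 := lt_of_le_of_lt hρU (by norm_num)
  homFloorW_of_prunedBoxSums hρU hρξ (prunedBoxSum_fcc_reduction_rad hε hfcc) fun G ξ hG hξ =>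
    (prunedBoxSum_hcp_reduction_rad hε hhcp G ξ hG hξ).imp (fun h M z c hz hr => Or.inr (h M z c hz hr)) id

/-- ★ The (I3) instance: `HomFloorW (1/8) (1/16) m` from pruned box sums over self-adjoint positive `U` with `‖U − 1‖ ≤ 1/8`, `‖ξ‖ ≤ 1/16`. [folklore] -/
theorem homFloorW_eighth_sixteenth_of_prunedBoxSums_selfAdjoint {m : ℝ}
    (hfcc : ∀ U : E3 →L[ℝ] E3, (∀ v w : E3, ⟪U v, w⟫ = ⟪v, U w⟫) → (∀ w : E3, 0 ≤ ⟪w, U w⟫) → ‖U - 1‖ ≤ 1 / 8 →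
      (∀ (M : ℕ) (z : Fin M → E3) (c : Fin M), Function.Injective z →
          Set.range z = {x : E3 | dist x (z c) ≤ 133 / 10 ∧ ∃ a : Fin 3 → ℤ, x = z c + latPt U fccVec a} →
          TightNearCap (9 / 5) (3 / 2) z c ∨ ExemptNear (9 / 5) ExRec z c ∨ BadNearCap (9 / 5) (3 / 2) z c) ∨
      m ≤ (∑ b ∈ (Fintype.piFinset fun _ : Fin 3 => Finset.Icc (-7 : ℤ) 7).filter (fun b => b ≠ 0),
        effPot w₄₅ ω₄ (3 / 400) ‖latPt U fccVec b‖) / 2 - (-(7175 / 10000) + 3 / 400))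
    (hhcp : ∀ (U : E3 →L[ℝ] E3) (ξ : E3), (∀ v w : E3, ⟪U v, w⟫ = ⟪v, U w⟫) → (∀ w : E3, 0 ≤ ⟪w, U w⟫) →
      ‖U - 1‖ ≤ 1 / 8 → ‖ξ‖ ≤ 1 / 16 →
      (∀ (M : ℕ) (z : Fin M → E3) (c : Fin M), Function.Injective z →
          Set.range z = {x : E3 | dist x (z c) ≤ 133 / 10 ∧ ∃ a : Fin 3 → ℤ,
            x = z c + latPt U hexFrame a ∨ x = z c + latPt U hexFrame a + U (hcpShift + ξ)} →
          TightNearCap (9 / 5) (3 / 2) z c ∨ ExemptNear (9 / 5) ExRec z c ∨ BadNearCap (9 / 5) (3 / 2) z c) ∨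
      m ≤ (∑ b ∈ (Fintype.piFinset fun _ : Fin 3 => Finset.Icc (-7 : ℤ) 7).filter (fun b => b ≠ 0),
          effPot w₄₅ ω₄ (3 / 400) ‖latPt U hexFrame b‖ +
        ∑ b ∈ (Fintype.piFinset fun _ : Fin 3 => Finset.Icc (-7 : ℤ) 7),
          effPot w₄₅ ω₄ (3 / 400) ‖latPt U hexFrame b + U (hcpShift + ξ)‖) / 2 - (-(7175 / 10000) + 3 / 400)) :
    HomFloorW (1 / 8) (1 / 16) m :=
  homFloorW_of_prunedBoxSums_selfAdjoint (by norm_num) (by norm_num) hfcc hhcp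

end Summit.AtomisticToContinuum.Crystallization.Theorems.FrustratedLawDichotomyStrainedPatchHomSplitNarrow

end
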